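import Literature.AlgebraicGeometry.Motives.IntegralModelRestrictScalarsAway
import Literature.AlgebraicGeometry.Motives.IntegralModelFibreCountEtale
import Literature.AlgebraicGeometry.Motives.GaloisThickeningSheetCover
import Literature.AlgebraicGeometry.Motives.SpecialFibreFrobeniusPoints
import HarnessLib

/-!
# Sheets of the points of a restricted model: the SHEET MODEL, the structure morphism as a model morphism, and
# «DISJOINT SPECIAL SHEETS» at the primes where the sheet model is étale

Topic `Literature/AlgebraicGeometry/Motives`; namespace `Literature.AlgebraicGeometry.Motives.IntegralModel`.  Plumbing `def`s
(`trivialModel`, `sheetModel`, `strHom`, `toSheetScheme`, `genericSheet`, and the number-field forms `sheetModelOf`, `strHomOf`,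
`specialSheet`, + 2 private) and theorems; no named fact, no instance, no notation, no `sorry`.  Cell `hodgecm-mathlib`, P6 «MOD programme», sub-desk
P6a — organ «INT-RES-SHEETS» (LEAD F0P6-plan M-12c (a), F0P6c-plan «= (β)», F0P6-ref1 n25 (J6), 2026-09-01): the SHEET STRUCTURE that the
sheet-wise Frobenius shadow `Fr₀ x̄ := θ(γ_{s(x̄)}, 1)_s⁻¹ (F̃ x̄)` of the moduli heart needs (SHEETS-2), delivered GENERICALLY for every model
that IS a restriction of scalars (★ `restrictScalars` ∕ `restrictScalarsOfIntermediate`, organ INT-RES) — which MH's `𝓜` is on the only road we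
have (RSZ model over `𝒪_{E′}[1∕N]` viewed over `𝓞 F`).  HC_CM is proved only modulo the printed citations until rung 0 closes; nothing here
is about HC.

THE MATHEMATICS.  Square `A → K`, `B → L` with `L = B ⊗_A K` as in INT-RES.  The TRIVIAL model of `Spec L` over `B` (total space `Spec B`)
restricts to the **sheet model** `𝓑` over `A` of `Spec L` regarded over `K`; for a model `𝓜` over `B` of an `L`-scheme `Z`, the structure
morphism `𝓜.total → Spec B` IS a morphism of `A`-models `str : restrictScalars 𝓜 ⟶ 𝓑` whose generic fibre is `Z → Spec L` regarded over `K`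
(`genericFibre_map_strHom` — the one computation of the file: two maps into `Spec L = Spec B ×_{Spec A} Spec K` agree iff they agree after the
two projections, Mathlib `IsPullback.hom_ext`).  Consequently the SHEET of a point is read through `𝓑` at every level and all compatibilities
are ★ BY NAME: for number fields `F ⊆ L`, `𝓞 L ⊆ B ⊆ L`, and a prime `w` of `F`, the sheet of a `κ̄(w)`-point of the special fibre of
`(restrictScalarsOfIntermediate hinj 𝓜).localise w` is its image in `(𝓑.localise w)_s(κ̄(w))` (`specialSheet`), the sheet of an `Ω`-point of
`Z∕F` is its image in `(Spec L ∕ F)(Ω)` (`genericSheet`; = ★ `embOfPoint`, `embOfPoint_genericSheet`); `specialSheet ∘ red_𝓜 = red_𝓑 ∘ genericSheet`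
(★ `geomReductionMap_map`); `specialSheet ∘ F̃ = F̃ ∘ specialSheet` (★ `AlgPoints.map_frobeniusOver_map`); `specialSheet` intertwines model
endomorphisms covering an endomorphism of `𝓑` (functoriality); and **DISJOINT SPECIAL SHEETS**: when `𝓑.localise w` is ÉTALE and proper over
`𝒪_{F,(w)}`, `red_𝓑` is injective (★ `ncard_fibre_geomReductionMap_eq_one_of_etale` against the trivial model of `Spec F`), so two `Ω`-points with
the same reduction lie on the same sheet (`genericSheet_eq_of_geomReductionMap_eq`).  The sequel `IntegralModelRestrictScalarsSheetsThickening`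
proves that this holds for all but finitely many `w` (★ SP-F spreading from the étale generic fibre `Spec L → Spec F`) and restates it in the
thickening currency of MH (`red_𝓨 (ℓ_e P) = θ(β,1)_s (red_𝓨 (ℓ_e Q)) → β = 1`, the hypothesis `hdisj` of FROB-SHEET ED. 3).
[GortzWedhorn2020] §(4.8), (14.20); [SerreTate1968] §1; [EGAIV4] 18.5.17.

NOT here: the identification of `𝓑_s(κ̄(w))` with the `𝓞 F`-algebra maps `B → κ̄(w)` and the Frobenius element of a sheet (★
`NumberFields/FrobeniusElementOfSheet`, organ SHEET-FROB — the residue-side `γ_{s(x̄)}`), the sheet-wise `Fr₀` itself (FROB-SHEET ED. 3,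
A-p01 (g23), over the hypothesis delivered here).
-/

set_option autoImplicit false

noncomputable section

set_option backward.isDefEq.respectTransparency false

open CategoryTheory CategoryTheory.Limits AlgebraicGeometry IsDedekindDomain IsDedekindDomain.HeightOneSpectrum
open scoped NumberField nonZeroDivisors
open Literature.NumberTheory.EllipticCurves (genericFibre)
open Literature.NumberTheory.DiophantineGeometry (geomResidueField specialFibreFunctor)
open Literature.AlgebraicGeometry.RelativeSpec (ActionOver)

namespace Literature.AlgebraicGeometry.Motives.IntegralModel

/-! ## §1 The trivial model of `Spec L` over `B` and the sheet model over `A` -/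

section Trivial

variable (B L : Type) [CommRing B] [Field L] [Algebra B L]

/-- **The trivial model of `Spec L` over `B`**: total space `Spec B → Spec B` (the identity), generic isomorphism the second projection
`Spec B ×_{Spec B} Spec L ≅ Spec L` (an isomorphism since the first leg is the identity). [folklore] -/
def trivialModel : IntegralModel B L (Over.mk (𝟙 (Spec (.of L)))) where
  total := Over.mk (𝟙 (Spec (.of B)))
  genericIso := Over.isoMk (asIso (pullback.snd (𝟙 (Spec (.of B))) (Spec.map (CommRingCat.ofHom (algebraMap B L))))) (by
    change pullback.snd _ _ ≫ 𝟙 _ = pullback.snd _ _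
    exact Category.comp_id _)

/-- The total space of the trivial model is `Spec B` over itself. [cite: SerreTate1968, §1] -/
theorem trivialModel_total : (trivialModel B L).total = Over.mk (𝟙 (Spec (.of B))) := rfl

/-- The generic isomorphism of the trivial model on underlying schemes is the second projection. [cite: SerreTate1968, §1] -/
theorem trivialModel_genericIso_hom_left :
    (trivialModel B L).genericIso.hom.left = pullback.snd (𝟙 (Spec (.of B))) (Spec.map (CommRingCat.ofHom (algebraMap B L))) := rfl

end Trivial

section Sheet

variable {A K B L : Type} [CommRing A] [Field K] [Algebra A K] [CommRing B] [Field L] [Algebra B L]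
  [Algebra A B] [Algebra K L] [Algebra A L] [IsScalarTower A B L] [IsScalarTower A K L] [Algebra.IsPushout A B K L]

variable (A K B L) in
/-- **The SHEET MODEL**: the trivial model of `Spec L` over `B`, viewed over `A` — an `A`-model (total space `Spec B → Spec A`) of `Spec L`
regarded over `K`; its points at each level are the SHEETS at that level. [cite: GortzWedhorn2020, Prop. 4.16 and §(4.8)] -/
def sheetModel : IntegralModel A K (SchemeOver.restrictScalars K (Over.mk (𝟙 (Spec (.of L))))) :=
  restrictScalars (A := A) (K := K) (trivialModel B L)

/-- The total space of the sheet model is `Spec B → Spec A`. [cite: GortzWedhorn2020, Prop. 4.16 and §(4.8)] -/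
theorem sheetModel_total_hom :
    (sheetModel A K B L).total.hom = 𝟙 (Spec (.of B)) ≫ Spec.map (CommRingCat.ofHom (algebraMap A B)) := rfl

/-- The underlying scheme of the sheet model is `Spec B`. [cite: GortzWedhorn2020, Prop. 4.16 and §(4.8)] -/
theorem sheetModel_total_left : (sheetModel A K B L).total.left = Spec (.of B) := rfl

variable {Z : SchemeOver L}

variable (K) in
/-- `Z → Spec L` regarded over `K`: the morphism from `Z∕K` to `(Spec L)∕K` whose underlying map is the structure morphism of `Z`.
[cite: GortzWedhorn2020, Prop. 4.16 and §(4.8)] -/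
def toSheetScheme (Z : SchemeOver L) :
    SchemeOver.restrictScalars K Z ⟶ SchemeOver.restrictScalars K (Over.mk (𝟙 (Spec (.of L)))) :=
  Over.homMk Z.hom (by
    change Z.hom ≫ 𝟙 _ ≫ Spec.map (CommRingCat.ofHom (algebraMap K L)) = Z.hom ≫ Spec.map (CommRingCat.ofHom (algebraMap K L))
    rw [Category.id_comp])

/-- The underlying map of `toSheetScheme` is `Z.hom`. [cite: GortzWedhorn2020, Prop. 4.16 and §(4.8)] -/
@[simp] theorem toSheetScheme_left (Z : SchemeOver L) : (toSheetScheme K Z).left = Z.hom := rfl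

/-- **The structure morphism as a MODEL MORPHISM**: `𝓜.total → Spec B` is a morphism over `Spec A` from the restricted model to the sheet
model. [cite: GortzWedhorn2020, Prop. 4.16 and §(4.8)] -/
def strHom (𝓜 : IntegralModel B L Z) : (restrictScalars (A := A) (K := K) 𝓜).total ⟶ (sheetModel A K B L).total :=
  Over.homMk 𝓜.total.hom (by simp [restrictScalars_total_hom, sheetModel_total_hom])

/-- The underlying map of `strHom` is the structure morphism `𝓜.total.hom`. [cite: GortzWedhorn2020, Prop. 4.16 and §(4.8)] -/
@[simp] theorem strHom_left (𝓜 : IntegralModel B L Z) : (strHom (A := A) (K := K) 𝓜).left = 𝓜.total.hom := rfl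

/-- **Generic fibre of the structure morphism**: through the generic isomorphisms of the restricted model and of the sheet model,
`str ⊗_A K` is `Z → Spec L` regarded over `K`.  (Two maps into `Spec L = Spec B ×_{Spec A} Spec K` agree iff they agree after the projections
to `Spec B` and `Spec K` — Mathlib `IsPullback.hom_ext` on ★ `isPullback_specMap_of_isPushout`.) [cite: GortzWedhorn2020, Prop. 4.16 and §(4.8)] -/
theorem genericFibre_map_strHom (𝓜 : IntegralModel B L Z) :
    (baseChange A K).map (strHom (A := A) (K := K) 𝓜) ≫ (sheetModel A K B L).genericIso.hom =
      (restrictScalars (A := A) (K := K) 𝓜).genericIso.hom ≫ toSheetScheme K Z := by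
  ext : 1
  rw [Over.comp_left, Over.comp_left, toSheetScheme_left]
  -- the two generic isomorphisms against the projection to `Spec B`
  have hB1 : (sheetModel A K B L).genericIso.hom.left ≫ Spec.map (CommRingCat.ofHom (algebraMap B L)) =
      pullback.fst ((trivialModel B L).total.hom ≫ Spec.map (CommRingCat.ofHom (algebraMap A B)))
        (Spec.map (CommRingCat.ofHom (algebraMap A K))) := by
    change ((restrictScalarsLeftIso (A := A) (K := K) (trivialModel B L)).hom ≫
        pullback.snd (𝟙 (Spec (.of B))) (Spec.map (CommRingCat.ofHom (algebraMap B L)))) ≫ _ = _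
    rw [Category.assoc, ← pullback.condition, Category.comp_id]
    exact restrictScalarsLeftIso_hom_fst (A := A) (K := K) (trivialModel B L)
  have hM1 : (restrictScalars (A := A) (K := K) 𝓜).genericIso.hom.left ≫ Z.hom ≫ Spec.map (CommRingCat.ofHom (algebraMap B L)) =
      pullback.fst (𝓜.total.hom ≫ Spec.map (CommRingCat.ofHom (algebraMap A B))) (Spec.map (CommRingCat.ofHom (algebraMap A K))) ≫
        𝓜.total.hom := by
    have hw : 𝓜.genericIso.hom.left ≫ Z.hom = pullback.snd 𝓜.total.hom (Spec.map (CommRingCat.ofHom (algebraMap B L))) :=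
      Over.w 𝓜.genericIso.hom
    rw [restrictScalars_genericIso_hom_left, Category.assoc, reassoc_of% hw, ← pullback.condition,
      restrictScalarsLeftIso_hom_fst_assoc]
  -- … and against the projection to `Spec K`
  have hB2 : (sheetModel A K B L).genericIso.hom.left ≫ Spec.map (CommRingCat.ofHom (algebraMap K L)) =
      pullback.snd ((trivialModel B L).total.hom ≫ Spec.map (CommRingCat.ofHom (algebraMap A B)))
        (Spec.map (CommRingCat.ofHom (algebraMap A K))) := by
    have hw := Over.w (sheetModel A K B L).genericIso.hom
    have h' : (SchemeOver.restrictScalars K (Over.mk (𝟙 (Spec (.of L))))).hom = Spec.map (CommRingCat.ofHom (algebraMap K L)) := by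
      change 𝟙 _ ≫ _ = _
      exact Category.id_comp _
    rw [h'] at hw
    exact hw
  have hM2 : (restrictScalars (A := A) (K := K) 𝓜).genericIso.hom.left ≫ Z.hom ≫ Spec.map (CommRingCat.ofHom (algebraMap K L)) =
      pullback.snd (𝓜.total.hom ≫ Spec.map (CommRingCat.ofHom (algebraMap A B))) (Spec.map (CommRingCat.ofHom (algebraMap A K))) := by
    have hw := Over.w (restrictScalars (A := A) (K := K) 𝓜).genericIso.hom
    rw [SchemeOver.restrictScalars_hom] at hw
    exact hw
  -- the base-change of `str` against the two projections
  have hS1 : ((baseChange A K).map (strHom (A := A) (K := K) 𝓜)).left ≫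
        pullback.fst ((trivialModel B L).total.hom ≫ Spec.map (CommRingCat.ofHom (algebraMap A B)))
          (Spec.map (CommRingCat.ofHom (algebraMap A K))) =
      pullback.fst (𝓜.total.hom ≫ Spec.map (CommRingCat.ofHom (algebraMap A B))) (Spec.map (CommRingCat.ofHom (algebraMap A K))) ≫
        𝓜.total.hom :=
    baseChange_map_left_comp_fst (strHom (A := A) (K := K) 𝓜)
  have hS2 : ((baseChange A K).map (strHom (A := A) (K := K) 𝓜)).left ≫
        pullback.snd ((trivialModel B L).total.hom ≫ Spec.map (CommRingCat.ofHom (algebraMap A B)))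
          (Spec.map (CommRingCat.ofHom (algebraMap A K))) =
      pullback.snd (𝓜.total.hom ≫ Spec.map (CommRingCat.ofHom (algebraMap A B))) (Spec.map (CommRingCat.ofHom (algebraMap A K))) :=
    Over.w ((baseChange A K).map (strHom (A := A) (K := K) 𝓜))
  apply (isPullback_specMap_of_isPushout (A := A) (K := K) (B := B) (L := L)).hom_ext
  · rw [Category.assoc, hB1, hS1, Category.assoc, hM1]
  · rw [Category.assoc, hB2, hS2, Category.assoc, hM2]

end Sheet

/-! ## §2 Generic sheets: the sheet of an `Ω`-point of `Z ∕ K` is its image in `(Spec L ∕ K)(Ω)` (= ★ `embOfPoint`) -/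

section GenericSheet

variable {K L : Type} [Field K] [Field L] [Algebra K L] {Z : SchemeOver L} {Ω : Type} [Field Ω] [Algebra K Ω]

/-- Morphisms into `Spec X ∕ X = Over.mk (𝟙 X)` (the terminal object of `Over X`) are unique. [folklore] -/
private theorem hom_mk_id_ext {X : Scheme} {T : Over X} (f g : T ⟶ Over.mk (𝟙 X)) : f = g := by
  ext : 1
  have hf : f.left ≫ 𝟙 X = T.hom := Over.w f
  have hg : g.left ≫ 𝟙 X = T.hom := Over.w g
  erw [Category.comp_id] at hf hg
  rw [hf, hg]

/-- **The sheet of a generic point**: the image of an `Ω`-point of `Z` regarded over `K` in the `Ω`-points of `Spec L` regarded over `K`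
(the sheets `L → Ω` over `K`, ★ `embOfPoint`). [cite: GortzWedhorn2020, §(4.8) and (14.20)] -/
def genericSheet (x : AlgPoints (SchemeOver.restrictScalars K Z) Ω) :
    AlgPoints (SchemeOver.restrictScalars K (Over.mk (𝟙 (Spec (.of L))))) Ω :=
  AlgPoints.map (toSheetScheme K Z) x

/-- Unfolding `genericSheet`. [cite: GortzWedhorn2020, §(4.8) and (14.20)] -/
theorem genericSheet_eq (x : AlgPoints (SchemeOver.restrictScalars K Z) Ω) :
    genericSheet x = AlgPoints.map (toSheetScheme K Z) x := rfl

/-- The sheet of a point of `Spec L ∕ K`, read as an embedding, is determined by (indeed is) the point: `Spec (embOfPoint s) = s`.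
[cite: GortzWedhorn2020, §(4.8) and (14.20)] -/
theorem specMap_embOfPoint_sheet (s : AlgPoints (SchemeOver.restrictScalars K (Over.mk (𝟙 (Spec (.of L))))) Ω) :
    Spec.map (CommRingCat.ofHom (AlgPoints.embOfPoint (Over.mk (𝟙 (Spec (.of L)))) s).toRingHom) = s.left := by
  rw [AlgPoints.specMap_ofHom_embOfPoint]
  change s.left ≫ 𝟙 _ = s.left
  exact Category.comp_id _

/-- Two points of `Spec L ∕ K` with the same embedding `L → Ω` are equal. [cite: GortzWedhorn2020, §(4.8) and (14.20)] -/
theorem sheet_eq_of_embOfPoint_eq {s s' : AlgPoints (SchemeOver.restrictScalars K (Over.mk (𝟙 (Spec (.of L))))) Ω}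
    (h : AlgPoints.embOfPoint (Over.mk (𝟙 (Spec (.of L)))) s = AlgPoints.embOfPoint (Over.mk (𝟙 (Spec (.of L)))) s') : s = s' := by
  ext : 1
  rw [← specMap_embOfPoint_sheet s, ← specMap_embOfPoint_sheet s', h]

/-- **`genericSheet` IS ★ `embOfPoint`**: the embedding of the sheet of `x` is the embedding `σ_x : L → Ω` of `x`.
[cite: GortzWedhorn2020, §(4.8) and (14.20)] -/
theorem embOfPoint_genericSheet (x : AlgPoints (SchemeOver.restrictScalars K Z) Ω) :
    AlgPoints.embOfPoint (Over.mk (𝟙 (Spec (.of L)))) (genericSheet x) = AlgPoints.embOfPoint Z x := by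
  apply AlgHom.coe_ringHom_injective
  rw [← AlgHom.toRingHom_eq_coe, ← AlgHom.toRingHom_eq_coe, AlgPoints.embOfPoint_toRingHom, AlgPoints.embOfPoint_toRingHom]
  have h : Spec.preimage ((genericSheet x).left ≫ (Over.mk (𝟙 (Spec (.of L)))).hom) = Spec.preimage (x.left ≫ Z.hom) := by
    apply Spec.map_injective
    rw [Spec.map_preimage, Spec.map_preimage]
    change (x ≫ toSheetScheme K Z).left ≫ 𝟙 _ = x.left ≫ Z.hom
    rw [Over.comp_left, toSheetScheme_left]
    exact Category.comp_id _
  rw [h]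

end GenericSheet

/-! ## §3 Number fields: the sheet model of an intermediate ring `𝓞 L ⊆ B ⊆ L`, localised at a prime `w` of `F` -/

section NumberField

variable {F L : Type} [Field F] [NumberField F] [Field L] [NumberField L] [Algebra F L]
  {B : Type} [CommRing B] [Algebra (𝓞 L) B] [Algebra B L] [IsScalarTower (𝓞 L) B L]
  [Algebra (𝓞 F) B] [IsScalarTower (𝓞 F) B L]
  (hinj : Function.Injective (algebraMap B L)) {Z : SchemeOver L}

/-- **The sheet model over `𝓞 F`** of `Spec L ∕ F` for the intermediate ring `B` (total space `Spec B → Spec 𝓞 F`): ★ `sheetModel` at the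
pushout square ★ `isPushout_of_injective`. [cite: GortzWedhorn2020, Prop. 4.16 and §(4.8)] -/
def sheetModelOf : IntegralModel (𝓞 F) F (SchemeOver.restrictScalars F (Over.mk (𝟙 (Spec (.of L))))) :=
  haveI := isPushout_of_injective (F := F) hinj
  sheetModel (𝓞 F) F B L

/-- `sheetModelOf` is `sheetModel` at the square `𝓞 F → F`, `B → L`. [cite: GortzWedhorn2020, Prop. 4.16 and §(4.8)] -/
theorem sheetModelOf_eq : haveI := isPushout_of_injective (F := F) hinj; sheetModelOf (F := F) hinj = sheetModel (𝓞 F) F B L := rfl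

/-- Its underlying scheme is `Spec B`. [cite: GortzWedhorn2020, Prop. 4.16 and §(4.8)] -/
theorem sheetModelOf_total_left : (sheetModelOf (F := F) hinj).total.left = Spec (.of B) := rfl

/-- Its structure morphism is `Spec B → Spec 𝓞 F` (after an identity). [cite: GortzWedhorn2020, Prop. 4.16 and §(4.8)] -/
theorem sheetModelOf_total_hom :
    (sheetModelOf (F := F) hinj).total.hom = 𝟙 (Spec (.of B)) ≫ Spec.map (CommRingCat.ofHom (algebraMap (𝓞 F) B)) := rfl

/-- **The structure morphism of a restricted model as a model morphism to the sheet model** (number-field form).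
[cite: GortzWedhorn2020, Prop. 4.16 and §(4.8)] -/
def strHomOf (𝓜 : IntegralModel B L Z) : (restrictScalarsOfIntermediate (F := F) hinj 𝓜).total ⟶ (sheetModelOf (F := F) hinj).total :=
  haveI := isPushout_of_injective (F := F) hinj
  strHom (A := 𝓞 F) (K := F) 𝓜

/-- The underlying map of `strHomOf` is `𝓜.total.hom`. [cite: GortzWedhorn2020, Prop. 4.16 and §(4.8)] -/
@[simp] theorem strHomOf_left (𝓜 : IntegralModel B L Z) : (strHomOf (F := F) hinj 𝓜).left = 𝓜.total.hom := rfl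

/-- Generic fibre of `strHomOf`: `Z → Spec L` regarded over `F`. [cite: GortzWedhorn2020, Prop. 4.16 and §(4.8)] -/
theorem genericFibre_map_strHomOf (𝓜 : IntegralModel B L Z) :
    (baseChange (𝓞 F) F).map (strHomOf (F := F) hinj 𝓜) ≫ (sheetModelOf (F := F) hinj).genericIso.hom =
      (restrictScalarsOfIntermediate (F := F) hinj 𝓜).genericIso.hom ≫ toSheetScheme F Z :=
  haveI := isPushout_of_injective (F := F) hinj
  genericFibre_map_strHom (A := 𝓞 F) (K := F) 𝓜

variable (w : HeightOneSpectrum (𝓞 F))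

/-- Generic fibre of the LOCALISED structure morphism at `w` (★ SP-F `genericFibre_map_localiseMap`): still `Z → Spec L` over `F`, now through
the `genericIso'` of the localised models. [cite: SerreTate1968, §1] -/
theorem genericFibre_map_localiseMap_strHomOf (𝓜 : IntegralModel B L Z) :
    (genericFibre (valuationSubringAtPrime F w) F).map
          (localiseMap _ _ (strHomOf (F := F) hinj 𝓜) w) ≫ ((sheetModelOf (F := F) hinj).localise w).genericIso'.hom =
      ((restrictScalarsOfIntermediate (F := F) hinj 𝓜).localise w).genericIso'.hom ≫ toSheetScheme F Z :=
  genericFibre_map_localiseMap _ _ (strHomOf (F := F) hinj 𝓜) (toSheetScheme F Z) (genericFibre_map_strHomOf hinj 𝓜) w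

/-- **The sheet of a special point**: the image of a `κ̄(w)`-point of the special fibre of the localised restricted model in the special
fibre of the localised sheet model. [cite: GortzWedhorn2020, §(4.8) and (14.20)] -/
def specialSheet (𝓜 : IntegralModel B L Z)
    (xbar : AlgPoints ((restrictScalarsOfIntermediate (F := F) hinj 𝓜).localise w).reductionAt (geomResidueField w)) :
    AlgPoints ((sheetModelOf (F := F) hinj).localise w).reductionAt (geomResidueField w) :=
  AlgPoints.map ((specialFibreFunctor w).map (localiseMap _ _ (strHomOf (F := F) hinj 𝓜) w)) xbar

/-- Unfolding `specialSheet`. [cite: GortzWedhorn2020, §(4.8) and (14.20)] -/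
theorem specialSheet_eq (𝓜 : IntegralModel B L Z)
    (xbar : AlgPoints ((restrictScalarsOfIntermediate (F := F) hinj 𝓜).localise w).reductionAt (geomResidueField w)) :
    specialSheet hinj w 𝓜 xbar = AlgPoints.map ((specialFibreFunctor w).map (localiseMap _ _ (strHomOf (F := F) hinj 𝓜) w)) xbar := rfl

/-- **The special sheet of a reduction is the reduction of the generic sheet**: `specialSheet (red_𝓜 x) = red_𝓑 (genericSheet x)` — ★
`geomReductionMap_map` at the localised structure morphism. [cite: SerreTate1968, §1] -/
theorem specialSheet_geomReductionMap (𝓜 : IntegralModel B L Z)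
    [IsProper ((restrictScalarsOfIntermediate (F := F) hinj 𝓜).localise w).total.hom] [IsProper ((sheetModelOf (F := F) hinj).localise w).total.hom]
    (x : AlgPoints (SchemeOver.restrictScalars F Z) (AlgebraicClosure (w.adicCompletion F))) :
    specialSheet hinj w 𝓜 (((restrictScalarsOfIntermediate (F := F) hinj 𝓜).localise w).geomReductionMap x) =
      ((sheetModelOf (F := F) hinj).localise w).geomReductionMap (genericSheet x) :=
  (geomReductionMap_map _ _ (localiseMap _ _ (strHomOf (F := F) hinj 𝓜) w) (toSheetScheme F Z)
    (genericFibre_map_localiseMap_strHomOf hinj w 𝓜) x).symm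

/-- **Sheets commute with the geometric Frobenius**: `specialSheet (F̃ x̄) = F̃ (specialSheet x̄)` (★ `AlgPoints.map_frobeniusOver_map`).
[cite: Hartshorne1977, IV Rem. 2.4.1] -/
theorem specialSheet_frobenius (𝓜 : IntegralModel B L Z)
    (xbar : AlgPoints ((restrictScalarsOfIntermediate (F := F) hinj 𝓜).localise w).reductionAt (geomResidueField w)) :
    specialSheet hinj w 𝓜 (AlgPoints.map (frobeniusOver _) xbar) = AlgPoints.map (frobeniusOver _) (specialSheet hinj w 𝓜 xbar) :=
  (AlgPoints.map_frobeniusOver_map _ xbar).symm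

/-- **Sheets are functorial**: a model endomorphism `u` of the localised restricted model covering an endomorphism `g` of the localised sheet
model (`u ≫ str = str ≫ g`) moves special sheets by `g_s`. [cite: GortzWedhorn2020, §(4.8) and (14.20)] -/
theorem specialSheet_map_of_comp_eq (𝓜 : IntegralModel B L Z)
    (u : ((restrictScalarsOfIntermediate (F := F) hinj 𝓜).localise w).total ⟶ ((restrictScalarsOfIntermediate (F := F) hinj 𝓜).localise w).total)
    (g : ((sheetModelOf (F := F) hinj).localise w).total ⟶ ((sheetModelOf (F := F) hinj).localise w).total)
    (h : u ≫ localiseMap _ _ (strHomOf (F := F) hinj 𝓜) w = localiseMap _ _ (strHomOf (F := F) hinj 𝓜) w ≫ g)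
    (xbar : AlgPoints ((restrictScalarsOfIntermediate (F := F) hinj 𝓜).localise w).reductionAt (geomResidueField w)) :
    specialSheet hinj w 𝓜 (AlgPoints.map ((specialFibreFunctor w).map u) xbar) =
      AlgPoints.map ((specialFibreFunctor w).map g) (specialSheet hinj w 𝓜 xbar) := by
  rw [specialSheet_eq, specialSheet_eq, ← AlgPoints.map_comp_apply, ← AlgPoints.map_comp_apply, ← Functor.map_comp,
    ← Functor.map_comp, h]

/-! ### DISJOINT SPECIAL SHEETS: at the primes where the sheet model is étale, equal reductions force equal sheets -/

/-- The structure morphism of the localised sheet model as a model morphism to the trivial model of `Spec F` over `𝒪_{F,(w)}`. [folklore] -/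
private def sheetToBase : ((sheetModelOf (F := F) hinj).localise w).total ⟶ (trivialModel (valuationSubringAtPrime F w) F).total :=
  Over.homMk ((sheetModelOf (F := F) hinj).localise w).total.hom (Category.comp_id _)

/-- `Spec L ∕ F → Spec F ∕ F`. [folklore] -/
private def sheetSchemeToBase : SchemeOver.restrictScalars F (Over.mk (𝟙 (Spec (.of L)))) ⟶ Over.mk (𝟙 (Spec (.of F))) :=
  Over.homMk (SchemeOver.restrictScalars F (Over.mk (𝟙 (Spec (.of L))))).hom (Category.comp_id _)

/-- **DISJOINT SPECIAL SHEETS (sheet form).**  If the localised sheet model `𝓑 ⊗ 𝒪_{F,(w)}` is ÉTALE and proper over `𝒪_{F,(w)}` (e.g.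
`IsSmoothProper 0`, true for all but finitely many `w`), then two `Ω`-points of `Z ∕ F` with the SAME reduction in the localised restricted
model have the SAME sheet: the reduction map of a proper étale model is injective (★ `ncard_fibre_geomReductionMap_eq_one_of_etale`, Hensel over
the henselian ring `𝒪_{\overline{F_w}}`). [cite: EGAIV4, Thm. 18.5.17] [cite: SerreTate1968, §1] -/
theorem genericSheet_eq_of_geomReductionMap_eq (𝓜 : IntegralModel B L Z)
    [IsProper ((restrictScalarsOfIntermediate (F := F) hinj 𝓜).localise w).total.hom]
    (h𝓑 : ((sheetModelOf (F := F) hinj).localise w).IsSmoothProper 0)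
    (x y : AlgPoints (SchemeOver.restrictScalars F Z) (AlgebraicClosure (w.adicCompletion F)))
    (h : ((restrictScalarsOfIntermediate (F := F) hinj 𝓜).localise w).geomReductionMap x =
      ((restrictScalarsOfIntermediate (F := F) hinj 𝓜).localise w).geomReductionMap y) :
    genericSheet x = genericSheet y := by
  haveI : IsProper ((sheetModelOf (F := F) hinj).localise w).total.hom := h𝓑.2
  haveI : Etale ((sheetModelOf (F := F) hinj).localise w).total.hom := (Etale.iff_smoothOfRelativeDimension_zero _).mpr h𝓑.1
  haveI : IsProper (trivialModel (valuationSubringAtPrime F w) F).total.hom := by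
    change IsProper (𝟙 _); infer_instance
  haveI : Etale ((⊤ : ((sheetModelOf (F := F) hinj).localise w).total.left.Opens).ι ≫ (sheetToBase hinj w).left) := by
    change Etale ((⊤ : ((sheetModelOf (F := F) hinj).localise w).total.left.Opens).ι ≫ ((sheetModelOf (F := F) hinj).localise w).total.hom)
    infer_instance
  -- the generic square of `sheetToBase` (both sides map into the terminal object `Spec F ∕ F`)
  have hπp : (genericFibre (valuationSubringAtPrime F w) F).map (sheetToBase hinj w) ≫
        (trivialModel (valuationSubringAtPrime F w) F).genericIso'.hom =
      ((sheetModelOf (F := F) hinj).localise w).genericIso'.hom ≫ sheetSchemeToBase := hom_mk_id_ext _ _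
  set 𝓑 := (sheetModelOf (F := F) hinj).localise w with h𝓑def
  set z := 𝓑.geomReductionMap (genericSheet x) with hz
  have hcount := ncard_fibre_geomReductionMap_eq_one_of_etale (trivialModel (valuationSubringAtPrime F w) F) 𝓑 (sheetToBase hinj w)
    sheetSchemeToBase hπp ⊤ (AlgPoints.map sheetSchemeToBase (genericSheet x)) z
    (geomReductionMap_map 𝓑 _ (sheetToBase hinj w) sheetSchemeToBase hπp (genericSheet x)).symm (TopologicalSpace.Opens.mem_top _)
  obtain ⟨a, ha⟩ := Set.ncard_eq_one.mp hcount
  have hx : genericSheet x ∈ ({a} : Set _) := by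
    rw [← ha]; exact ⟨rfl, rfl⟩
  have hy : genericSheet y ∈ ({a} : Set _) := by
    rw [← ha]
    refine ⟨hom_mk_id_ext _ _, ?_⟩
    rw [hz, ← specialSheet_geomReductionMap hinj w 𝓜 x, h, specialSheet_geomReductionMap hinj w 𝓜 y]
  rw [Set.mem_singleton_iff] at hx hy
  rw [hx, hy]

end NumberField

end Literature.AlgebraicGeometry.Motives.IntegralModel
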